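import Literature.NumberTheory.GaloisRepresentations.TateLevelOneLocalGenerators
import HarnessLib

/-!
# Tate's theorem `H²(G_ℚ, ℚ/ℤ) = 0` at level one, II′: the wild place `ℚ_2`
# (Serre, Durham 1977, §6.5 (a), (b); the case `p = 2`)

Sibling proof file (theorems only) of `TateProjectiveLifting.lean`, companion of
`TateLevelOneWildOdd.lean`.  At `ℚ_2` the group `X(Γ_{ℚ_2})` of continuous characters
`Γ_{ℚ_2} → ℚ/ℤ` is **not** `2`-divisible: `X/2X ≅ ℤ/2`, generated by the character `ψ₄` of
`ℚ_2(i)/ℚ_2` (`(ℤ/2^m)ˣ = {±1} × ⟨5⟩` is not cyclic).  We prove exactly what the level-one argument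
needs:

* `zmod_four_units_eq_one_or_eq_neg_one`, `signFour`, `signFour_mul`, … — the character `s₄` of
  `(ℤ/4)ˣ = {±1}` with `s₄(-1) = 1/2`;
* `zmod_two_pow_units_character_eq` — an additive character `h` of `(ℤ/2^{m+2})ˣ` trivial on
  `Ker((ℤ/2^{m+2})ˣ → (ℤ/2^m)ˣ)` is `h(x) = j • s₄(x mod 4) + 2 h'(x)`
  (`(ℤ/2^{m+2})ˣ = {±1} × ⟨5⟩`, `orderOf 5 = 2^m`, `ZMod.orderOf_five`);
* `adicCompletion_rat_character_two_eq` — **every locally constant character `λ` of `Γ_{ℚ_2}` is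
  `λ = j • ψ₄ + 2 λ'`** with `ψ₄ = s₄ ∘ χ_4` and `λ'` locally constant (local Kronecker–Weber on
  inertia, `adicCompletion_rat_exists_eq_comp_cyclotomicCharacter_of_mem_absInertia`, plus the
  unramified quotient `≅ Ẑ`);
* `adicCompletion_rat_psiFour_not_two_divisible` — **`ψ₄|_{Γ_{ℚ_2}} ∉ 2X(Γ_{ℚ_2})`**
  (`χ_{2^m}(I_{ℚ_2}) ∋ -1`);
* `adicCompletion_rat_twoCocycle_two_split_generator_form` — the local datum at `2` for the
  level-one argument: every locally constant `2`-torsion `2`-cocycle on `Γ_{ℚ_2}` is `∂β` with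
  `β` locally constant and `2β = j • ψ₄`.

## References

* J.-P. Serre, *Modular forms of weight one and Galois representations* (Durham 1977), §6.5 (a),
  (b). [SerreDurham1977]
* J.-P. Serre, *Local Fields* (1979), Ch. XIV §7 (`ℚ_p^{ab}`; `ℤ_2ˣ = {±1} × (1 + 4ℤ_2)`).
  [SerreLocalFields1979]
-/

noncomputable section

open Field ValuativeRel IsDedekindDomain NumberField
open scoped Pointwise NumberField

namespace Literature.NumberTheory.GaloisRepresentations

/-! ### The character `s₄` of `(ℤ/4)ˣ` -/

section Four

/-- `(ℤ/4)ˣ = {1, -1}`. [folklore] -/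
theorem zmod_four_units_eq_one_or_eq_neg_one (u : (ZMod 4)ˣ) : u = 1 ∨ u = -1 := by
  have hcard : Fintype.card (ZMod 4)ˣ = 2 := by rw [ZMod.card_units_eq_totient]; decide
  have hne : (-1 : (ZMod 4)ˣ) ≠ 1 := by decide
  by_contra h
  rw [not_or] at h
  have h3 : 3 ≤ Fintype.card (ZMod 4)ˣ := by
    have : ({u, 1, -1} : Finset (ZMod 4)ˣ).card = 3 := by
      rw [Finset.card_insert_of_notMem, Finset.card_insert_of_notMem, Finset.card_singleton]
      · simpa using hne.symm
      · simp [h.1, h.2]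
    calc 3 = ({u, 1, -1} : Finset (ZMod 4)ˣ).card := this.symm
      _ ≤ Fintype.card (ZMod 4)ˣ := Finset.card_le_univ _
  omega

/-- The additive character `s₄ : (ℤ/4)ˣ → ℚ/ℤ` with `s₄(1) = 0`, `s₄(-1) = 1/2`. [folklore] -/
def signFour (u : (ZMod 4)ˣ) : AddCircle (1 : ℚ) :=
  if u = 1 then 0 else (((1 : ℚ) / 2 : ℚ) : AddCircle (1 : ℚ))

/-- `s₄(1) = 0`. [folklore] -/
theorem signFour_one : signFour 1 = 0 := if_pos rfl

/-- `s₄(-1) = 1/2`. [folklore] -/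
theorem signFour_neg_one : signFour (-1) = (((1 : ℚ) / 2 : ℚ) : AddCircle (1 : ℚ)) :=
  if_neg (by decide)

/-- `2 • (1/2) = 0` in `ℚ/ℤ`. [folklore] -/
theorem two_nsmul_one_half_addCircle : 2 • ((((1 : ℚ) / 2 : ℚ)) : AddCircle (1 : ℚ)) = 0 := by
  rw [← AddCircle.coe_nsmul, nsmul_eq_mul]
  norm_num [AddCircle.coe_eq_zero_iff]

/-- `1/2 ≠ 0` in `ℚ/ℤ`. [folklore] -/
theorem one_half_addCircle_ne_zero : ((((1 : ℚ) / 2 : ℚ)) : AddCircle (1 : ℚ)) ≠ 0 := by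
  rw [Ne, AddCircle.coe_eq_zero_iff]
  rintro ⟨n, hn⟩
  rw [zsmul_eq_mul, mul_one] at hn
  have h2 : ((2 * n : ℤ) : ℚ) = 1 := by push_cast; linarith
  have : (2 * n : ℤ) = 1 := by exact_mod_cast h2
  omega

/-- `s₄` is `2`-torsion valued. [folklore] -/
theorem two_nsmul_signFour (u : (ZMod 4)ˣ) : 2 • signFour u = 0 := by
  unfold signFour
  split_ifs
  · exact smul_zero _
  · exact two_nsmul_one_half_addCircle

/-- `s₄` is an additive character of `(ℤ/4)ˣ`. [folklore] -/
theorem signFour_mul (u v : (ZMod 4)ˣ) : signFour (u * v) = signFour u + signFour v := by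
  rcases zmod_four_units_eq_one_or_eq_neg_one u with rfl | rfl <;>
    rcases zmod_four_units_eq_one_or_eq_neg_one v with rfl | rfl
  · rw [one_mul, signFour_one, add_zero]
  · rw [one_mul, signFour_one, zero_add]
  · rw [mul_one, signFour_one, add_zero]
  · rw [show (-1 : (ZMod 4)ˣ) * -1 = 1 from by rw [neg_mul_neg, one_mul], signFour_one,
      signFour_neg_one, ← two_nsmul, two_nsmul_one_half_addCircle]

/-- A `2`-torsion element of `ℚ/ℤ` is `0` or `1/2`, i.e. an integer multiple of `1/2`. [folklore] -/
theorem exists_eq_zsmul_one_half_of_two_nsmul_eq_zero {y : AddCircle (1 : ℚ)} (hy : 2 • y = 0) :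
    ∃ j : ℤ, y = j • ((((1 : ℚ) / 2 : ℚ)) : AddCircle (1 : ℚ)) := by
  obtain ⟨e, -, he_apply, he_surj⟩ := zmod_exists_addMonoidHom_addCircle (N := 2) two_pos
  obtain ⟨k, hk⟩ := he_surj y hy
  refine ⟨(k.val : ℤ), ?_⟩
  have h1 : y = e ((k.val : ℤ) : ZMod 2) := by rw [Int.cast_natCast, ZMod.natCast_zmod_val, hk]
  rw [h1, he_apply, ← AddCircle.coe_zsmul, zsmul_eq_mul]
  congr 1
  push_cast
  ring

end Four

/-! ### `(ℤ/2^{m+3})ˣ = {±1} × ⟨5⟩` and its characters -/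

section UnitsTwoPow

/-- The unit `5 ∈ (ℤ/2^n)ˣ`. [folklore] -/
def unitFive (n : ℕ) : (ZMod (2 ^ n))ˣ :=
  ZMod.unitOfCoprime 5 ((by norm_num : Nat.Coprime 5 2).pow_right n)

/-- The unit `5` has value `5`. [folklore] -/
theorem coe_unitFive (n : ℕ) : (unitFive n : ZMod (2 ^ n)) = 5 := by
  rw [unitFive, ZMod.coe_unitOfCoprime, Nat.cast_ofNat]

/-- `orderOf 5 = 2^{m+1}` in `(ℤ/2^{m+3})ˣ` (`ZMod.orderOf_five`). [folklore] -/
theorem orderOf_unitFive (m : ℕ) : orderOf (unitFive (m + 3)) = 2 ^ (m + 1) := by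
  rw [← orderOf_units, coe_unitFive]
  exact ZMod.orderOf_five (m + 1)

/-- `4 ∣ 2^{m+3}`. [folklore] -/
theorem four_dvd_two_pow (m : ℕ) : 4 ∣ 2 ^ (m + 3) := ⟨2 ^ (m + 1), by ring⟩

/-- The reduction `(ℤ/2^{m+3})ˣ → (ℤ/4)ˣ` sends `-1 ↦ -1`. [folklore] -/
theorem unitsMap_four_neg_one (m : ℕ) :
    ZMod.unitsMap (four_dvd_two_pow m) (-1 : (ZMod (2 ^ (m + 3)))ˣ) = -1 := by
  ext
  rw [ZMod.unitsMap_def, Units.coe_map, MonoidHom.coe_coe, Units.val_neg, Units.val_one, map_neg,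
    map_one, Units.val_neg, Units.val_one]

/-- The reduction `(ℤ/2^{m+3})ˣ → (ℤ/4)ˣ` sends `5 ↦ 1`. [folklore] -/
theorem unitsMap_four_unitFive (m : ℕ) :
    ZMod.unitsMap (four_dvd_two_pow m) (unitFive (m + 3)) = 1 := by
  ext
  rw [ZMod.unitsMap_def, Units.coe_map, MonoidHom.coe_coe, coe_unitFive, map_ofNat, Units.val_one]
  decide

/-- `Ker((ℤ/2^{m+3})ˣ → (ℤ/4)ˣ) = ⟨5⟩`. [folklore] -/
theorem ker_unitsMap_four_eq_zpowers_unitFive (m : ℕ) :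
    (ZMod.unitsMap (four_dvd_two_pow m)).ker = Subgroup.zpowers (unitFive (m + 3)) := by
  symm
  apply Subgroup.eq_of_le_of_card_ge
  · rw [Subgroup.zpowers_le, MonoidHom.mem_ker, unitsMap_four_unitFive]
  · -- both have `2^{m+1}` elements
    have hz : Nat.card (Subgroup.zpowers (unitFive (m + 3))) = 2 ^ (m + 1) := by
      rw [Nat.card_zpowers, orderOf_unitFive]
    have hU : Nat.card (ZMod (2 ^ (m + 3)))ˣ = 2 ^ (m + 2) := by
      rw [Nat.card_eq_fintype_card, ZMod.card_units_eq_totient,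
        show m + 3 = (m + 2) + 1 from rfl, Nat.totient_prime_pow_succ Nat.prime_two]
      simp
    have hidx : (ZMod.unitsMap (four_dvd_two_pow m)).ker.index = 2 := by
      rw [Subgroup.index_ker, MonoidHom.range_eq_top.mpr (ZMod.unitsMap_surjective _),
        Subgroup.card_top, Nat.card_eq_fintype_card, ZMod.card_units_eq_totient]
      decide
    have hk := Subgroup.card_mul_index (ZMod.unitsMap (four_dvd_two_pow m)).ker
    rw [hidx, hU] at hk
    have h2 : 2 ^ (m + 2) = 2 ^ (m + 1) * 2 := pow_succ 2 (m + 1)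
    rw [hz]
    omega

/-- Every `u ∈ (ℤ/2^{m+3})ˣ` reduces to `±1 (mod 4)`: `u` or `-u` reduces to `1`. [folklore] -/
theorem unitsMap_four_eq_one_or (m : ℕ) (x : (ZMod (2 ^ (m + 3)))ˣ) :
    ZMod.unitsMap (four_dvd_two_pow m) x = 1 ∨ ZMod.unitsMap (four_dvd_two_pow m) (-x) = 1 := by
  rcases zmod_four_units_eq_one_or_eq_neg_one (ZMod.unitsMap (four_dvd_two_pow m) x) with h | h
  · exact Or.inl h
  · right
    rw [← neg_one_mul, map_mul, unitsMap_four_neg_one, h, neg_mul_neg, one_mul]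

/-- **Characters of `(ℤ/2^{m+3})ˣ` trivial on `Ker(→ (ℤ/2^{m+1})ˣ)`**: such an additive character
`h : (ℤ/2^{m+3})ˣ → ℚ/ℤ` is `h(x) = j • s₄(x mod 4) + 2 h'(x)` for an integer `j` and an additive
character `h'` (`(ℤ/2^{m+3})ˣ = {±1} × ⟨5⟩` with `5` of order `2^{m+1}`, and `h` kills
`5^{2^m} ≡ 1 (mod 2^{m+1})`, so `h|_{⟨5⟩}` is a `2`-nd multiple; `h(-1) ∈ {0, 1/2}`).
[cite: SerreLocalFields1979, Ch. XIV §7] -/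
theorem zmod_two_pow_units_character_eq (m : ℕ) (h : (ZMod (2 ^ (m + 3)))ˣ → AddCircle (1 : ℚ))
    (hadd : ∀ x y, h (x * y) = h x + h y)
    (hker : ∀ x, ZMod.unitsMap (pow_dvd_pow 2 (by omega : m + 1 ≤ m + 3)) x = 1 → h x = 0) :
    ∃ (j : ℤ) (h' : (ZMod (2 ^ (m + 3)))ˣ → AddCircle (1 : ℚ)), (∀ x y, h' (x * y) = h' x + h' y) ∧
      ∀ x, h x = j • signFour (ZMod.unitsMap (four_dvd_two_pow m) x) + 2 • h' x := by
  classical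
  set π₄ := ZMod.unitsMap (four_dvd_two_pow m) with hπ₄
  set u5 := unitFive (m + 3) with hu5
  set G : Subgroup (ZMod (2 ^ (m + 3)))ˣ := Subgroup.zpowers u5 with hG
  -- the cyclic part: `h|_G = 2 • hG'`
  set g₀ : G := ⟨u5, Subgroup.mem_zpowers u5⟩ with hg₀
  have hgen : ∀ y : G, y ∈ Subgroup.zpowers g₀ := fun y => by
    obtain ⟨k, hk⟩ := Subgroup.mem_zpowers_iff.mp y.2
    exact Subgroup.mem_zpowers_iff.mpr ⟨k, Subtype.ext (by rw [Subgroup.coe_zpow]; exact hk)⟩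
  have hord : orderOf g₀ = 2 * 2 ^ m := by
    rw [← Subgroup.orderOf_coe, show ((g₀ : G) : (ZMod (2 ^ (m + 3)))ˣ) = u5 from rfl, hu5,
      orderOf_unitFive, pow_succ, mul_comm]
  have hvan : (fun y : G => h y) (g₀ ^ 2 ^ m) = 0 := by
    show h ((g₀ ^ 2 ^ m : G) : (ZMod (2 ^ (m + 3)))ˣ) = 0
    apply hker
    rw [Subgroup.coe_pow, map_pow, show ((g₀ : G) : (ZMod (2 ^ (m + 3)))ˣ) = u5 from rfl]
    have hc : Fintype.card (ZMod (2 ^ (m + 1)))ˣ = 2 ^ m := by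
      rw [ZMod.card_units_eq_totient, Nat.totient_prime_pow_succ Nat.prime_two]
      simp
    rw [← hc, pow_card_eq_one]
  obtain ⟨hG', hG'_add, hG'_spec⟩ := cyclic_character_nsmul_divisible_of_apply_pow_eq_zero g₀ hgen
    two_pos (pow_pos two_pos m) hord (fun y : G => h y) (fun x y => hadd x y) hvan
  -- the sign part: `h(-1) = j/2`
  have h1 : h 1 = 0 := character_apply_one hadd
  have h2neg : 2 • h (-1) = 0 := by
    rw [two_nsmul, ← hadd, neg_mul_neg, one_mul, h1]
  obtain ⟨j, hj⟩ := exists_eq_zsmul_one_half_of_two_nsmul_eq_zero h2neg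
  -- the projection `x ↦ |x| ∈ G`
  have hmemG : ∀ x, π₄ x = 1 → x ∈ G := fun x hx => by
    rw [hG, hu5, ← ker_unitsMap_four_eq_zpowers_unitFive, MonoidHom.mem_ker]
    exact hx
  set absU : (ZMod (2 ^ (m + 3)))ˣ → (ZMod (2 ^ (m + 3)))ˣ :=
    fun x => if π₄ x = 1 then x else -x with habsU
  have habs_mem : ∀ x, absU x ∈ G := fun x => by
    simp only [habsU]
    split_ifs with hx
    · exact hmemG x hx
    · rcases unitsMap_four_eq_one_or m x with h' | h'
      · exact absurd h' hx
      · exact hmemG _ h'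
  have hne : (-1 : (ZMod 4)ˣ) ≠ 1 := by decide
  have habs_mul : ∀ x y, absU (x * y) = absU x * absU y := fun x y => by
    simp only [habsU]
    rcases zmod_four_units_eq_one_or_eq_neg_one (π₄ x) with hx | hx <;>
      rcases zmod_four_units_eq_one_or_eq_neg_one (π₄ y) with hy | hy
    · rw [if_pos (by rw [map_mul, hx, hy, one_mul]), if_pos hx, if_pos hy]
    · rw [if_neg (by rw [map_mul, hx, hy, one_mul]; exact hne), if_pos hx,
        if_neg (by rw [hy]; exact hne), mul_neg]
    · rw [if_neg (by rw [map_mul, hx, hy, mul_one]; exact hne), if_neg (by rw [hx]; exact hne),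
        if_pos hy, neg_mul]
    · rw [if_pos (by rw [map_mul, hx, hy, neg_mul_neg, one_mul]), if_neg (by rw [hx]; exact hne),
        if_neg (by rw [hy]; exact hne), neg_mul_neg]
  -- the character `h'`
  refine ⟨j, fun x => hG' ⟨absU x, habs_mem x⟩, fun x y => ?_, fun x => ?_⟩
  · rw [← hG'_add]
    show hG' ⟨absU (x * y), habs_mem (x * y)⟩ = hG' (⟨absU x, habs_mem x⟩ * ⟨absU y, habs_mem y⟩)
    congr 1
    exact Subtype.ext (habs_mul x y)
  · rw [hG'_spec]
    show h x = j • signFour (π₄ x) + h (absU x)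
    simp only [habsU]
    rcases zmod_four_units_eq_one_or_eq_neg_one (π₄ x) with hx | hx
    · rw [hx, if_pos rfl, signFour_one, smul_zero, zero_add]
    · rw [hx, if_neg hne, signFour_neg_one, ← hj]
      conv_lhs => rw [← neg_neg x, ← neg_one_mul, hadd]

end UnitsTwoPow

/-! ### The theorems at `ℚ_2` -/

section RatTwo

open scoped Valued

variable (v : HeightOneSpectrum (𝓞 ℚ))

/-- **At `ℚ_2` every locally constant character `λ : Γ_{ℚ_2} → ℚ/ℤ` is `j • ψ₄ + 2 λ'`** with
`ψ₄ = s₄ ∘ χ_4` the character of `ℚ_2(i)/ℚ_2` (valued in `(1/2)ℤ/ℤ`) and `λ'` locally constant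
(Serre, Durham §6.5 (b), `p = 2`: `X(Γ_{ℚ_2})/2X ≅ ℤ/2`).  On inertia `λ = g ∘ χ_{2^m}` (local
Kronecker–Weber, `adicCompletion_rat_exists_eq_comp_cyclotomicCharacter_of_mem_absInertia`);
`zmod_two_pow_units_character_eq` writes `g` two levels up as `j • s₄ + 2 h'`; the unramified
remainder is divisible (`unramified_character_nsmul_divisible`).
[cite: SerreDurham1977, §6.5 (b)] [cite: SerreLocalFields1979, Ch. XIV §7] -/
theorem adicCompletion_rat_character_two_eq (hv : (Rat.HeightOneSpectrum.primesEquiv v : ℕ) = 2)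
    [NeZero ((4 : ℕ) : v.adicCompletion ℚ)]
    (lam : absoluteGaloisGroup (v.adicCompletion ℚ) → AddCircle (1 : ℚ))
    (hlc : IsLocallyConstant lam) (hadd : ∀ σ τ, lam (σ * τ) = lam σ + lam τ) :
    ∃ (j : ℤ) (lam' : absoluteGaloisGroup (v.adicCompletion ℚ) → AddCircle (1 : ℚ)),
      IsLocallyConstant lam' ∧ (∀ σ τ, lam' (σ * τ) = lam' σ + lam' τ) ∧
      ∀ σ, lam σ = j • signFour (modNCyclotomicCharacter (v.adicCompletion ℚ) 4 σ) + 2 • lam' σ := by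
  classical
  haveI : Fact (Nat.Prime 2) := ⟨Nat.prime_two⟩
  haveI : CharZero (v.adicCompletion ℚ) := charZero_adicCompletion (K := ℚ) v
  haveI h2F : NeZero ((2 : ℕ) : v.adicCompletion ℚ) := ⟨Nat.cast_ne_zero.mpr two_ne_zero⟩
  -- (1) local Kronecker–Weber on inertia
  obtain ⟨f, hf, hfker⟩ := exists_monoidHom_ker_iff hadd
  have hopen : IsOpen ((f.ker : Subgroup _) : Set (absoluteGaloisGroup (v.adicCompletion ℚ))) := by
    have : ((f.ker : Subgroup _) : Set (absoluteGaloisGroup (v.adicCompletion ℚ))) = lam ⁻¹' {0} := by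
      ext τ
      exact hfker τ
    rw [this]
    exact hlc.isOpen_fiber 0
  obtain ⟨m, hm, g, hg⟩ :=
    adicCompletion_rat_exists_eq_comp_cyclotomicCharacter_of_mem_absInertia 2 v hv f hopen
      (fun a b => mul_comm _ _)
  obtain ⟨m₀, rfl⟩ : ∃ m₀, m = m₀ + 1 := Nat.exists_eq_succ_of_ne_zero hm.ne'
  haveI : NeZero ((2 ^ (m₀ + 1) : ℕ) : v.adicCompletion ℚ) :=
    ⟨by rw [Nat.cast_pow]; exact pow_ne_zero _ h2F.out⟩
  haveI : NeZero ((2 ^ (m₀ + 3) : ℕ) : v.adicCompletion ℚ) :=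
    ⟨by rw [Nat.cast_pow]; exact pow_ne_zero _ h2F.out⟩
  haveI : NeZero (2 ^ (m₀ + 1)) := ⟨pow_ne_zero _ two_ne_zero⟩
  haveI : NeZero (2 ^ (m₀ + 3)) := ⟨pow_ne_zero _ two_ne_zero⟩
  have hI : ∀ σ ∈ absInertia (v.adicCompletion ℚ), lam σ =
      Multiplicative.toAdd (g (modNCyclotomicCharacter (v.adicCompletion ℚ) (2 ^ (m₀ + 1)) σ)) :=
    fun σ hσ => by
      have h1 := hg σ hσ
      rw [hf] at h1
      rw [modNCyclotomicCharacter_eq_unitsMap_cyclotomicCharacter, ← h1, toAdd_ofAdd]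
  -- (2) two levels up: `h = g ∘ π` on `(ℤ/2^{m₀+3})ˣ`
  set π : (ZMod (2 ^ (m₀ + 3)))ˣ →* (ZMod (2 ^ (m₀ + 1)))ˣ :=
    ZMod.unitsMap (pow_dvd_pow 2 (by omega : m₀ + 1 ≤ m₀ + 3)) with hπ_def
  set h : (ZMod (2 ^ (m₀ + 3)))ˣ → AddCircle (1 : ℚ) :=
    fun x => Multiplicative.toAdd (g (π x)) with hh_def
  have hh_add : ∀ x y, h (x * y) = h x + h y := fun x y => by
    simp only [hh_def, map_mul, toAdd_mul]
  have hker : ∀ x, π x = 1 → h x = 0 := fun x hx => by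
    simp only [hh_def]
    rw [hx, map_one, toAdd_one]
  obtain ⟨j, h', hh'_add, hh'⟩ := zmod_two_pow_units_character_eq m₀ h hh_add hker
  -- (3) `μ' = h' ∘ χ_{2^{m₀+3}}`
  have hω_lc := isLocallyConstant_modNCyclotomicCharacter (v.adicCompletion ℚ) (2 ^ (m₀ + 3))
  set μ' : absoluteGaloisGroup (v.adicCompletion ℚ) → AddCircle (1 : ℚ) :=
    fun σ => h' (modNCyclotomicCharacter (v.adicCompletion ℚ) (2 ^ (m₀ + 3)) σ) with hμ'_def
  have hμ'_lc : IsLocallyConstant μ' := hω_lc.comp h'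
  have hμ'_add : ∀ σ τ, μ' (σ * τ) = μ' σ + μ' τ := fun σ τ => by
    simp only [hμ'_def, map_mul, hh'_add]
  have hψ_lc : IsLocallyConstant fun σ : absoluteGaloisGroup (v.adicCompletion ℚ) =>
      signFour (modNCyclotomicCharacter (v.adicCompletion ℚ) 4 σ) :=
    (isLocallyConstant_modNCyclotomicCharacter (v.adicCompletion ℚ) 4).comp signFour
  have hψ_add : ∀ σ τ : absoluteGaloisGroup (v.adicCompletion ℚ),
      signFour (modNCyclotomicCharacter (v.adicCompletion ℚ) 4 (σ * τ)) =
        signFour (modNCyclotomicCharacter (v.adicCompletion ℚ) 4 σ) +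
          signFour (modNCyclotomicCharacter (v.adicCompletion ℚ) 4 τ) := fun σ τ => by
    rw [map_mul, signFour_mul]
  have hIeq : ∀ σ ∈ absInertia (v.adicCompletion ℚ),
      lam σ = j • signFour (modNCyclotomicCharacter (v.adicCompletion ℚ) 4 σ) + 2 • μ' σ :=
    fun σ hσ => by
      have h1 : lam σ = h (modNCyclotomicCharacter (v.adicCompletion ℚ) (2 ^ (m₀ + 3)) σ) := by
        rw [hI σ hσ]
        simp only [hh_def, hπ_def]
        rw [unitsMap_modNCyclotomicCharacter_of_dvd]
      rw [h1, hh']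
      simp only [hμ'_def]
      rw [unitsMap_modNCyclotomicCharacter_of_dvd]
  -- (4) the unramified remainder
  set ν : absoluteGaloisGroup (v.adicCompletion ℚ) → AddCircle (1 : ℚ) := fun σ =>
    lam σ - j • signFour (modNCyclotomicCharacter (v.adicCompletion ℚ) 4 σ) - 2 • μ' σ with hν_def
  have hν_lc : IsLocallyConstant ν :=
    (hlc.comp₂ hψ_lc fun a b => a - j • b).comp₂ hμ'_lc fun a b => a - 2 • b
  have hν_add : ∀ σ τ, ν (σ * τ) = ν σ + ν τ := fun σ τ => by
    simp only [hν_def, hadd, hμ'_add, hψ_add, nsmul_add, zsmul_add]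
    abel
  have hνI : ∀ σ ∈ absInertia (v.adicCompletion ℚ), ν σ = 0 := fun σ hσ => by
    simp only [hν_def, hIeq σ hσ]
    abel
  obtain ⟨ν', hν'_lc, hν'_add, -, hν'⟩ :=
    unramified_character_nsmul_divisible (v.adicCompletion ℚ) ν hν_lc hν_add hνI two_pos
  refine ⟨j, fun σ => μ' σ + ν' σ, hμ'_lc.comp₂ hν'_lc fun a b => a + b, fun σ τ => ?_, fun σ => ?_⟩
  · show μ' (σ * τ) + ν' (σ * τ) = (μ' σ + ν' σ) + (μ' τ + ν' τ)
    rw [hμ'_add, hν'_add]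
    abel
  · show lam σ = j • signFour (modNCyclotomicCharacter (v.adicCompletion ℚ) 4 σ) +
      2 • (μ' σ + ν' σ)
    rw [nsmul_add, hν']
    simp only [hν_def]
    abel

/-- **A character of `Γ_{ℚ_2}` taking the value `1/2` wherever `χ_4 = -1` is not a `2`-nd
multiple in `X(Γ_{ℚ_2})`** (`χ_{2^m}(I_{ℚ_2}) ∋ -1`, an element of order `2` in the level-`2^m`
quotient).  Equivalently, the Bockstein of `χ_{-1}` is non-zero at `2`.
[cite: SerreDurham1977, §6.5 (b)] -/
theorem adicCompletion_rat_not_two_divisible_of_modFour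
    (hv : (Rat.HeightOneSpectrum.primesEquiv v : ℕ) = 2) [NeZero ((4 : ℕ) : v.adicCompletion ℚ)]
    (μ : absoluteGaloisGroup (v.adicCompletion ℚ) → AddCircle (1 : ℚ))
    (hlc : IsLocallyConstant μ) (hadd : ∀ σ τ, μ (σ * τ) = μ σ + μ τ)
    (lam : absoluteGaloisGroup (v.adicCompletion ℚ) → AddCircle (1 : ℚ))
    (hlam : ∀ σ, modNCyclotomicCharacter (v.adicCompletion ℚ) 4 σ = -1 →
      lam σ = (((1 : ℚ) / 2 : ℚ) : AddCircle (1 : ℚ))) :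
    ¬ ∀ σ, 2 • μ σ = lam σ := by
  classical
  intro hμ
  haveI : Fact (Nat.Prime 2) := ⟨Nat.prime_two⟩
  haveI : CharZero (v.adicCompletion ℚ) := charZero_adicCompletion (K := ℚ) v
  haveI h2F : NeZero ((2 : ℕ) : v.adicCompletion ℚ) := ⟨Nat.cast_ne_zero.mpr two_ne_zero⟩
  obtain ⟨f, hf, hfker⟩ := exists_monoidHom_ker_iff hadd
  have hopen : IsOpen ((f.ker : Subgroup _) : Set (absoluteGaloisGroup (v.adicCompletion ℚ))) := by
    have : ((f.ker : Subgroup _) : Set (absoluteGaloisGroup (v.adicCompletion ℚ))) = μ ⁻¹' {0} := by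
      ext τ
      exact hfker τ
    rw [this]
    exact hlc.isOpen_fiber 0
  obtain ⟨m, hm, g, hg⟩ :=
    adicCompletion_rat_exists_eq_comp_cyclotomicCharacter_of_mem_absInertia 2 v hv f hopen
      (fun a b => mul_comm _ _)
  obtain ⟨m₀, rfl⟩ : ∃ m₀, m = m₀ + 1 := Nat.exists_eq_succ_of_ne_zero hm.ne'
  haveI : NeZero ((2 ^ (m₀ + 1) : ℕ) : v.adicCompletion ℚ) :=
    ⟨by rw [Nat.cast_pow]; exact pow_ne_zero _ h2F.out⟩
  haveI : NeZero ((2 ^ (m₀ + 3) : ℕ) : v.adicCompletion ℚ) :=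
    ⟨by rw [Nat.cast_pow]; exact pow_ne_zero _ h2F.out⟩
  haveI : NeZero (2 ^ (m₀ + 1)) := ⟨pow_ne_zero _ two_ne_zero⟩
  haveI : NeZero (2 ^ (m₀ + 3)) := ⟨pow_ne_zero _ two_ne_zero⟩
  -- `σ ∈ I` with `χ_{2^{m₀+3}}(σ) = -1`
  obtain ⟨σ, hσI, hσ⟩ := adicCompletion_rat_exists_mem_absInertia_modNCyclotomicCharacter_eq 2 v hv
    (m := m₀ + 3) (by omega) (-1)
  have h4 : modNCyclotomicCharacter (v.adicCompletion ℚ) 4 σ = -1 := by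
    rw [← unitsMap_modNCyclotomicCharacter_of_dvd (v.adicCompletion ℚ) (four_dvd_two_pow m₀), hσ,
      unitsMap_four_neg_one]
  have hsq : modNCyclotomicCharacter (v.adicCompletion ℚ) (2 ^ (m₀ + 1)) (σ * σ) = 1 := by
    rw [map_mul, ← unitsMap_modNCyclotomicCharacter_of_dvd (v.adicCompletion ℚ)
      (pow_dvd_pow 2 (by omega : m₀ + 1 ≤ m₀ + 3)), hσ, ← map_mul, neg_mul_neg, one_mul, map_one]
  have hμsq : μ (σ * σ) = 0 := by
    have h1 := hg (σ * σ) (mul_mem hσI hσI)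
    rw [hf] at h1
    rw [← toAdd_ofAdd (μ (σ * σ)), h1, ← modNCyclotomicCharacter_eq_unitsMap_cyclotomicCharacter,
      hsq, map_one, toAdd_one]
  have h2 := hμ σ
  rw [two_nsmul, ← hadd, hμsq, hlam σ h4] at h2
  exact one_half_addCircle_ne_zero h2.symm

/-- **`ψ₄|_{Γ_{ℚ_2}}` is not a `2`-nd multiple in `X(Γ_{ℚ_2})`**: there is no locally constant
character `μ` of `Γ_{ℚ_2}` with `2 μ = s₄ ∘ χ_4`. [cite: SerreDurham1977, §6.5 (b)] -/
theorem adicCompletion_rat_signFour_not_two_divisible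
    (hv : (Rat.HeightOneSpectrum.primesEquiv v : ℕ) = 2) [NeZero ((4 : ℕ) : v.adicCompletion ℚ)]
    (μ : absoluteGaloisGroup (v.adicCompletion ℚ) → AddCircle (1 : ℚ))
    (hlc : IsLocallyConstant μ) (hadd : ∀ σ τ, μ (σ * τ) = μ σ + μ τ) :
    ¬ ∀ σ, 2 • μ σ = signFour (modNCyclotomicCharacter (v.adicCompletion ℚ) 4 σ) :=
  adicCompletion_rat_not_two_divisible_of_modFour v hv μ hlc hadd _ fun σ h4 => by
    rw [h4, signFour_neg_one]

/-- **The local datum at `2` for the level-one argument**: every locally constant `2`-torsion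
`2`-cocycle `g` on `Γ_{ℚ_2}` is `∂β` with `β` locally constant and `2β = j • ψ₄`
(local Tate `H²(Γ_{ℚ_2}, ℚ/ℤ) = 0`, then `adicCompletion_rat_character_two_eq` applied to `2c`).
[cite: SerreDurham1977, §6.5 (a), (b)] -/
theorem adicCompletion_rat_twoCocycle_two_split_generator_form
    (hv : (Rat.HeightOneSpectrum.primesEquiv v : ℕ) = 2) [NeZero ((4 : ℕ) : v.adicCompletion ℚ)]
    (g : absoluteGaloisGroup (v.adicCompletion ℚ) → absoluteGaloisGroup (v.adicCompletion ℚ) →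
      AddCircle (1 : ℚ)) (hg : IsLocallyConstant (Function.uncurry g))
    (hcoc : ∀ σ τ υ, g σ τ + g (σ * τ) υ = g τ υ + g σ (τ * υ)) (h2g : ∀ σ τ, 2 • g σ τ = 0) :
    ∃ (β : absoluteGaloisGroup (v.adicCompletion ℚ) → AddCircle (1 : ℚ)) (j : ℤ),
      IsLocallyConstant β ∧ (∀ σ τ, g σ τ + β (σ * τ) = β σ + β τ) ∧
      ∀ σ, 2 • β σ = j • signFour (modNCyclotomicCharacter (v.adicCompletion ℚ) 4 σ) := by
  haveI : CompactSpace (absoluteGaloisGroup (v.adicCompletion ℚ)) := absoluteGaloisGroup_compactSpace _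
  obtain ⟨c₀, hc₀_lc, hc₀⟩ := by
    haveI : CharZero (v.adicCompletion ℚ) := charZero_adicCompletion (K := ℚ) v
    exact twoCocycle_addCircle_prime_split_localField (v.adicCompletion ℚ) Nat.prime_two g hg hcoc h2g
  obtain ⟨j, lam', hlam'_lc, hlam'_add, hlam'⟩ := adicCompletion_rat_character_two_eq v hv
    (fun σ => 2 • c₀ σ) (hc₀_lc.comp fun x => 2 • x) (character_nsmul_of_coboundary h2g hc₀)
  refine ⟨fun σ => c₀ σ - lam' σ, j, hc₀_lc.comp₂ hlam'_lc fun x y => x - y, fun σ τ => ?_,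
    fun σ => ?_⟩
  · show g σ τ + (c₀ (σ * τ) - lam' (σ * τ)) = (c₀ σ - lam' σ) + (c₀ τ - lam' τ)
    rw [hlam'_add, ← add_sub_assoc, hc₀]
    abel
  · show 2 • (c₀ σ - lam' σ) = j • signFour (modNCyclotomicCharacter (v.adicCompletion ℚ) 4 σ)
    rw [nsmul_sub, hlam', two_nsmul (lam' σ)]
    abel

end RatTwo

end Literature.NumberTheory.GaloisRepresentations

end
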